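import Mathlib
import Literature.NumberTheory.Irrationality.BrownZudilin2022.CellularZetaFive
import HarnessLib

/-!
# Brown–Zudilin 2022, Sect. 12: the `M_{0,10}` family "vanishing in the middle" (totally symmetric integrals `I_n`)

Topic `Literature/NumberTheory/Irrationality/BrownZudilin2022` (namespace of the directory). Source: F. Brown,
W. Zudilin, *On cellular rational approximations to ζ(5)*, arXiv:2210.03391v3 [BrownZudilin2022], Sect. 12
(pp. 29–30); the configuration is F. Brown, arXiv:1412.6508 [Brown2016], App. 2 §10.2.6, Example
"Vanishing in the middle", seating plan `(10,2,4,1,6,3,8,5,9,7)` on `M_{0,10}` (typed, with its kernel-checked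
convergence and self-duality, as `Brown2016.tenVanishingMiddle` in `Brown2016/OddConfigurations.lean`).

HONEST FRAMING (cell pub-zeta5): systematic search; no irrationality claim unless certified. Nothing here says
anything about the arithmetic nature of `ζ(5)` or `ζ(7)`; the source itself says only that "a similar analysis to
the one undertaken in this note might possibly lead to a result of the form 'at least one of `ζ(5)` and `ζ(7)` is
irrational'" [BrownZudilin2022, Sect. 12, p. 30].

## Contents
* `openSimplex7`, `vimNum`, `vimDen`, `vimIntegrand n`, `vimIntegral n` — the totally symmetric integrals of the
  family, verbatim from the display on p. 29:
  `I_n = ∫_{0<t₁<⋯<t₇<1} [t₁(t₂−t₁)(t₃−t₂)(t₄−t₃)(t₅−t₄)(t₆−t₅)(t₇−t₆)(1−t₇) / D(t)]ⁿ · dt₁⋯dt₇ / D(t)`,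
  `D(t) = (t₃−t₁)t₃t₅(t₅−t₂)(t₇−t₂)(t₇−t₄)(1−t₄)(1−t₆)` (a Bochner integral over the open simplex; PROVED:
  the integrand is positive on the simplex, `vimIntegrand_pos`);
* NAMED FACT `vim_values` — the three printed evaluations "the cases `n = 0, 1, 2` give"
  `I₀ = 75/4·ζ(7) − 9ζ(5)ζ(2)`,
  `I₁ = (61·75/4·ζ(7) − 300·3ζ(5) − 220) − (61·9ζ(5) − 300·2ζ(3) + 152)ζ(2)`,
  `I₂ = (52921·75/4·ζ(7) − 261153·3ζ(5) − 6021219/32) − (52921·9ζ(5) − 261153·2ζ(3) + 535857/4)ζ(2)`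
  (numerically `3.5554…`, `3.207…·10⁻⁵`, `1.053…·10⁻⁹` — the cell's calibration targets for this family).

## In docstrings only (EXPERIMENTAL / programme statements in print, not vendored as facts)
"Experimentally, it underlies a motive of rank 4 with semi-simple pieces `ℚ(0), ℚ(−2), ℚ(−5), ℚ(−7)`";
"On the surface, they give linear forms in `1, ζ(2), ζ₅, ζ₇` … we may write them as a combination of two linear
forms `I_n = I′_n + I″_n ζ(2)`, where `I″_n` is a linear form in `1, ζ(3), ζ(5)` and `I′_n` is a linear form in
`1, ζ(5), ζ(7)` obtained by setting `ζ(2) = 0` in `I_n`"; "the linear forms `I′_n` and `I″_n` are also small (but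
not as small as `I_n` itself)" [BrownZudilin2022, Sect. 12, pp. 29–30].
-/

noncomputable section

open MeasureTheory Set

namespace Literature.NumberTheory.Irrationality.BrownZudilin2022

open Literature.NumberTheory.Transcendental (zetaValue)

/-! ### The integrals `I_n` of Sect. 12 -/

/-- The open simplex `0 < t₁ < t₂ < ⋯ < t₇ < 1` in `ℝ⁷` (`t : Fin 7 → ℝ`, `t i` is `t_{i+1}`).
[cite: BrownZudilin2022, Sect. 12 (display p. 29)] -/
def openSimplex7 : Set (Fin 7 → ℝ) :=
  {t | 0 < t 0 ∧ t 0 < t 1 ∧ t 1 < t 2 ∧ t 2 < t 3 ∧ t 3 < t 4 ∧ t 4 < t 5 ∧ t 5 < t 6 ∧ t 6 < 1}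

/-- The numerator `t₁(t₂−t₁)(t₃−t₂)(t₄−t₃)(t₅−t₄)(t₆−t₅)(t₇−t₆)(1−t₇)`. [cite: BrownZudilin2022, Sect. 12 (display p. 29)] -/
def vimNum (t : Fin 7 → ℝ) : ℝ :=
  t 0 * (t 1 - t 0) * (t 2 - t 1) * (t 3 - t 2) * (t 4 - t 3) * (t 5 - t 4) * (t 6 - t 5) * (1 - t 6)

/-- The denominator `D(t) = (t₃−t₁) t₃ t₅ (t₅−t₂)(t₇−t₂)(t₇−t₄)(1−t₄)(1−t₆)`. [cite: BrownZudilin2022, Sect. 12 (display p. 29)] -/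
def vimDen (t : Fin 7 → ℝ) : ℝ :=
  (t 2 - t 0) * t 2 * t 4 * (t 4 - t 1) * (t 6 - t 1) * (t 6 - t 3) * (1 - t 3) * (1 - t 5)

/-- The integrand of `I_n`: `(vimNum t / D(t))ⁿ / D(t)`. [cite: BrownZudilin2022, Sect. 12 (display p. 29)] -/
def vimIntegrand (n : ℕ) (t : Fin 7 → ℝ) : ℝ :=
  (vimNum t / vimDen t) ^ n / vimDen t

/-- The totally symmetric integrals `I_n` of the `M_{0,10}` configuration `(10,2,4,1,6,3,8,5,9,7)` ("vanishing
in the middle"), as the Bochner integral of `vimIntegrand n` over `openSimplex7`.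
[cite: BrownZudilin2022, Sect. 12 (display p. 29)] -/
def vimIntegral (n : ℕ) : ℝ :=
  ∫ t in openSimplex7, vimIntegrand n t

/-- On the open simplex every factor of `vimNum` and `vimDen` is positive, hence so is the integrand (the
integrals `I_n` are integrals of positive functions). [cite: BrownZudilin2022, Sect. 12 (display p. 29)] -/
theorem vimIntegrand_pos (n : ℕ) {t : Fin 7 → ℝ} (ht : t ∈ openSimplex7) : 0 < vimIntegrand n t := by
  obtain ⟨h0, h1, h2, h3, h4, h5, h6, h7⟩ := ht
  have hnum : 0 < vimNum t := by unfold vimNum; positivity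
  have hden : 0 < vimDen t := by
    unfold vimDen
    have : 0 < t 2 - t 0 := by linarith
    have : 0 < t 4 - t 1 := by linarith
    have : 0 < t 6 - t 1 := by linarith
    have : 0 < t 6 - t 3 := by linarith
    have : 0 < 1 - t 3 := by linarith
    have : 0 < 1 - t 5 := by linarith
    have : 0 < t 2 := by linarith
    have : 0 < t 4 := by linarith
    positivity
  unfold vimIntegrand
  positivity

/-! ### The printed values -/

/-- **The first three integrals** (named fact; the printed evaluations): "the cases `n = 0, 1, 2` give
`I₀ = 75/4 ζ(7) − 9ζ(5)ζ(2)`,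
`I₁ = (61·75/4 ζ(7) − 300·3ζ(5) − 220) − (61·9ζ(5) − 300·2ζ(3) + 152)ζ(2)`,
`I₂ = (52921·75/4 ζ(7) − 261153·3ζ(5) − 6021219/32) − (52921·9ζ(5) − 261153·2ζ(3) + 535857/4)ζ(2)`".
[cite: BrownZudilin2022, Sect. 12 (p. 29)] -/
def vim_values : Prop :=
  vimIntegral 0 = 75 / 4 * zetaValue 7 - 9 * zetaValue 5 * zetaValue 2
  ∧ vimIntegral 1 =
      (61 * 75 / 4 * zetaValue 7 - 300 * 3 * zetaValue 5 - 220)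
        - (61 * 9 * zetaValue 5 - 300 * 2 * zetaValue 3 + 152) * zetaValue 2
  ∧ vimIntegral 2 =
      (52921 * 75 / 4 * zetaValue 7 - 261153 * 3 * zetaValue 5 - 6021219 / 32)
        - (52921 * 9 * zetaValue 5 - 261153 * 2 * zetaValue 3 + 535857 / 4) * zetaValue 2

/-- Reading of `vim_values` in the form "`I_n = I′_n + I″_n ζ(2)` with `I′_n ∈ ℚ + ℚζ(5) + ℚζ(7)`,
`I″_n ∈ ℚ + ℚζ(3) + ℚζ(5)`" for `n = 1`: `I′₁ = 4575/4·ζ(7) − 900ζ(5) − 220`, `I″₁ = −(549ζ(5) − 600ζ(3) + 152)`.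
[cite: BrownZudilin2022, Sect. 12 (pp. 29–30)] -/
theorem vim_values.decomposition_one (h : vim_values) :
    vimIntegral 1 = (4575 / 4 * zetaValue 7 - 900 * zetaValue 5 - 220)
      + (-(549 * zetaValue 5 - 600 * zetaValue 3 + 152)) * zetaValue 2 := by
  rw [h.2.1]; ring

end Literature.NumberTheory.Irrationality.BrownZudilin2022
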